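/-
Copyright (c) 2026 the pub-hodgecm-mathlib formalisation cell (harness21).  Prover seat hodgecm-mathlib-K2E3-p17 (g8), Track B «K2-LIT» ∕ h413
(`stmt-HodgeConjecture-24833`), line `K2_E3_EllipticInputs`, leaf (nsc-S-A′), H-layer brick LEV-3 (kit) of `MEMO-H4-residues.v1.K2E3-p25-g0.md` §1 (architect
K2E3-p25 (g0); dealer K2E3-plan (g4) RULINGS #3 (R-9) D76).  2026-09-04.
-/
import Literature.NumberTheory.Automorphic.WhittakerTwistedJacquet        -- ★ `Representation.charTwist`, `ker_charTwist_eq_span`, `IsSmooth.charTwist`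
import Literature.NumberTheory.Automorphic.AdditiveCharacterDuality       -- ★ `AddCharDuality.exists_eq_mulShift` (every continuous additive character is `ψ(a·)`)
import Literature.NumberTheory.Automorphic.JacquetModule                  -- ★ `IsLimitOfCompactOpen`
import Mathlib.RepresentationTheory.Coinvariants
import HarnessLib

/-!
# Crux `H413` — K2-LIT E3, H-layer brick LEV-3 (kit): transport of twisted-coinvariant kernels, coinvariants of quotients, and «every smooth character of a
# root group is `ψ(a·)`» (generic lemmas for rule (lev) `K2E3GL3DegenerateLevelOne`)

Cell `hodgecm-mathlib`, Track B, line `K2_E3_EllipticInputs`, leaf (nsc-S-A′) `sig_K2E3GL3PrincipalBlockStandardSpan`, H-layer rule (lev) of the architect's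
`MEMO-H4-residues.v1` §1 (K2E3-p25 (g0)): «`ω` irreducible smooth on `GL₃(F)`, `ω_{U₃,ψ_nd} = 0`, `ω_{U₃,ψ′} = 0 ⇒ ω` is one-dimensional».  This file is the GENERIC
kit of that proof (any group `G`, any commutative ring ∕ `ℂ`), THEOREMS ONLY; count-neutral helper (`--supports stmt-HodgeConjecture-24833 --as helper`).

* §1 **TRANSPORT**: `x ∈ G` with `x⁻¹ N x ⊆ N` and `Θ′(x⁻¹ n x) = Θ(n)` ⟹ `ω(x⁻¹)` maps `V(N, Θ) = ker (ω.charTwist N Θ)` into `V(N, Θ′)`; so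
  `V(N, Θ) = V ⇒ V(N, Θ′) = V` (`ker_charTwist_eq_top_of_conj`) — the torus conjugation `diag(c,1,1)` (`ψ_nd ↦ ψ(c u₀₁ + u₁₂)`) and the Levi transitivity
  on the characters of `U_Q ≅ F²` of rule (lev) are both instances.
* §2 **STAGES, the containment**: if every `g ∈ G` is `s · h` (`s ∈ S`, `h ∈ H`) then `ker ρ ≤ ker ρ|_S ⊔ ker ρ|_H` (and `=`); the `U₃ = U_Q ⋊ U_{α₁}` instance of
  LEV-2 `K2E3CoinvariantsInStages` (K2E5-p17 (g5)) — typed here independently so that LEV-3 does not wait; interchangeable by name.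
* §3 **QUOTIENTS**: for an invariant submodule `W` (Mathlib `Representation.quotient`), `mkQ (ker (ρ.twist χ)) ≤ ker ((ρ.quotient W _).twist χ)`; the quotient of a
  smooth representation is smooth; `ker = ⊤` upstairs and a complement ⇒ `ker = ⊤` downstairs (`ker_twist_quotient_eq_top_of_sup_eq_top`).
* §4 **SMOOTH CHARACTERS OF A ROOT GROUP ARE `ψ(a·)`**: a character `θ : M →* ℂˣ` with open kernel of a group `M` that is a union of compact open subgroups takes
  values of norm one (finite image on each compact open subgroup), so along a continuous additive parametrisation `e : F → M` it is a continuous `AddChar F Circle`,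
  hence `θ(e x) = ψ(a x)` by ★ additive duality (`exists_eq_mulShift_comp_of_isOpen_ker`); two-parameter version for `U_Q ≅ F²`.

HONEST LABEL: HC_CM is proved only modulo the 7 printed citations (2 remaining named inputs: hLiu418 = stmt-HodgeConjecture-24832, h413 =
stmt-HodgeConjecture-24833) until rung 0 closes; elementary, closes no organ by itself.

## References
* [BernsteinZelevinsky1976] I. N. Bernstein, A. V. Zelevinsky, *Representations of the group GL(n,F) where F is a non-archimedean local field*, Russian Math.
  Surveys 31:3 (1976), §2.30–§2.36 (the functors `r_{U,θ}`), §5.15 (the `P_n`-analysis behind derivatives).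
* [BernsteinZelevinskyASENS1977] I. N. Bernstein, A. V. Zelevinsky, *Induced representations of reductive p-adic groups I*, Ann. Sci. ÉNS 10 (1977), §1.8–1.9, 4.7.
* [BushnellHenniart2006] C. J. Bushnell, G. Henniart, *The Local Langlands Conjecture for GL(2)*, §1.7 Proposition (additive duality).
-/

set_option autoImplicit false
-- the mandated namespace repeats `HodgeConjecture.HodgeConjecture`, as in every `Theorems/*.lean` of this sub-problem
set_option linter.dupNamespace false

noncomputable section

open Representation Literature.NumberTheory.Automorphic

namespace Summit.HodgeConjecture.HodgeConjecture.Cruxes.H413.K2E3TwistedKernelTransport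

/-! ## §1 Transport of twisted kernels along a normalising element -/

section Transport

variable {k G V : Type*} [CommRing k] [Group G] [AddCommGroup V] [Module k V] (ω : Representation k G V)

/-- **TRANSPORT OF TWISTED KERNELS.**  If `x⁻¹ N x ⊆ N` and `Θ′(x⁻¹ n x) = Θ(n)` on `N`, then `ω(x⁻¹)` maps `V(N,Θ)` into `V(N,Θ′)`:
`ω(x⁻¹)(ω(n)v − Θ(n)v) = ω(n′)(ω(x⁻¹)v) − Θ′(n′)(ω(x⁻¹)v)`, `n′ = x⁻¹ n x`. [cite: BernsteinZelevinsky1976, §2.33] -/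
theorem map_ker_charTwist_le_of_conj (N : Subgroup G) (Θ Θ' : ↥N →* kˣ) (x : G)
    (hx : ∀ n : ↥N, x⁻¹ * (n : G) * x ∈ N) (hΘ : ∀ n : ↥N, Θ' ⟨x⁻¹ * (n : G) * x, hx n⟩ = Θ n) :
    Submodule.map (ω x⁻¹) (Coinvariants.ker (ω.charTwist N Θ)) ≤ Coinvariants.ker (ω.charTwist N Θ') := by
  rw [ker_charTwist_eq_span, Submodule.map_span, Submodule.span_le]
  rintro _ ⟨_, ⟨⟨n, v⟩, rfl⟩, rfl⟩
  have key : ω x⁻¹ (ω (n : G) v - (Θ n : kˣ) • v) =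
      ω ((⟨x⁻¹ * (n : G) * x, hx n⟩ : ↥N) : G) (ω x⁻¹ v) - (Θ' ⟨x⁻¹ * (n : G) * x, hx n⟩ : kˣ) • ω x⁻¹ v := by
    rw [hΘ, Units.smul_def, Units.smul_def, map_sub, map_smul]
    congr 1
    show ω x⁻¹ (ω (n : G) v) = ω (x⁻¹ * (n : G) * x) (ω x⁻¹ v)
    rw [map_mul, map_mul, Module.End.mul_apply, Module.End.mul_apply, ← Module.End.mul_apply (ω x) (ω x⁻¹) v, ← map_mul,
      mul_inv_cancel, map_one, Module.End.one_apply]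
  rw [key]
  exact sub_smul_mem_ker_charTwist ω N Θ' _ _

/-- **`V(N,Θ) = V ⇒ V(N,Θ′) = V`** under transport (`ω(x⁻¹)` is onto). [cite: BernsteinZelevinsky1976, §2.33] -/
theorem ker_charTwist_eq_top_of_conj (N : Subgroup G) (Θ Θ' : ↥N →* kˣ) (x : G)
    (hx : ∀ n : ↥N, x⁻¹ * (n : G) * x ∈ N) (hΘ : ∀ n : ↥N, Θ' ⟨x⁻¹ * (n : G) * x, hx n⟩ = Θ n)
    (htop : Coinvariants.ker (ω.charTwist N Θ) = ⊤) : Coinvariants.ker (ω.charTwist N Θ') = ⊤ := by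
  refine eq_top_iff.2 fun v _ => ?_
  have hv : v ∈ Submodule.map (ω x⁻¹) (Coinvariants.ker (ω.charTwist N Θ)) := by
    refine ⟨ω x v, by rw [htop]; exact Submodule.mem_top, ?_⟩
    rw [← Module.End.mul_apply, ← map_mul, inv_mul_cancel, map_one, Module.End.one_apply]
  exact map_ker_charTwist_le_of_conj ω N Θ Θ' x hx hΘ hv

/-- The restriction of a twisted restriction: for `S ≤ N` (as a subgroup of `↥N`), `(ω.charTwist N Θ)|_S` is the twist of `ω|_S` by `Θ|_S⁻¹`, so its kernel is spanned
by the `ω(s)v − Θ(s)v`, `s ∈ S`. [folklore] -/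
theorem ker_charTwist_comp_subtype_eq_span (N : Subgroup G) (Θ : ↥N →* kˣ) (S : Subgroup ↥N) :
    Coinvariants.ker ((ω.charTwist N Θ).comp S.subtype) =
      Submodule.span k (Set.range fun p : ↥S × V => ω ((p.1 : ↥N) : G) p.2 - (Θ (p.1 : ↥N) : kˣ) • p.2) := by
  refine le_antisymm (Submodule.span_le.2 ?_) (Submodule.span_le.2 ?_)
  · rintro _ ⟨⟨s, v⟩, rfl⟩
    have h1 := Submodule.smul_mem _ (((Θ (s : ↥N))⁻¹ : kˣ) : k)
      (Submodule.subset_span (s := Set.range fun p : ↥S × V => ω ((p.1 : ↥N) : G) p.2 - (Θ (p.1 : ↥N) : kˣ) • p.2) ⟨(s, v), rfl⟩)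
    dsimp only at h1 ⊢
    rwa [smul_sub, ← Units.smul_def, ← Units.smul_def, inv_smul_smul] at h1
  · rintro _ ⟨⟨s, v⟩, rfl⟩
    have h1 := Submodule.smul_mem (Coinvariants.ker ((ω.charTwist N Θ).comp S.subtype)) ((Θ (s : ↥N) : kˣ) : k)
      (Coinvariants.sub_mem_ker (ρ := (ω.charTwist N Θ).comp S.subtype) s v)
    dsimp only at h1 ⊢
    rwa [smul_sub, ← Units.smul_def, ← Units.smul_def, MonoidHom.comp_apply, Subgroup.subtype_apply, smul_charTwist_apply] at h1

/-- The kernel of the restriction to `S ≤ N` depends only on `Θ|_S`: if `Θ|_S = Θ′|_S` then `ker (ω.charTwist N Θ)|_S = ker (ω.charTwist N Θ′)|_S`. [folklore] -/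
theorem ker_charTwist_comp_subtype_congr (N : Subgroup G) (Θ Θ' : ↥N →* kˣ) (S : Subgroup ↥N) (h : ∀ s : ↥S, Θ (s : ↥N) = Θ' (s : ↥N)) :
    Coinvariants.ker ((ω.charTwist N Θ).comp S.subtype) = Coinvariants.ker ((ω.charTwist N Θ').comp S.subtype) := by
  rw [ker_charTwist_comp_subtype_eq_span, ker_charTwist_comp_subtype_eq_span]
  congr 1
  ext w
  simp only [Set.mem_range, h]

end Transport

/-! ## §2 Stages: the kernel for `G = S · H` -/

section Stages

variable {k G V : Type*} [CommRing k] [Group G] [AddCommGroup V] [Module k V] (ρ : Representation k G V)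

/-- `ker ρ|_S ≤ ker ρ`. [folklore] -/
theorem ker_comp_subtype_le (S : Subgroup G) : Coinvariants.ker (ρ.comp S.subtype) ≤ Coinvariants.ker ρ :=
  Submodule.span_le.2 (by rintro _ ⟨⟨s, v⟩, rfl⟩; exact Coinvariants.sub_mem_ker (s : G) v)

/-- **STAGES**: if every `g ∈ G` factors as `g = s · h` with `s ∈ S`, `h ∈ H`, then `ker ρ = ker ρ|_S ⊔ ker ρ|_H`
(`ρ(sh)v − v = (ρ(s)(ρ(h)v) − ρ(h)v) + (ρ(h)v − v)`). [cite: BernsteinZelevinsky1976, §2.32] -/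
theorem ker_eq_sup_of_forall_exists_mul (S H : Subgroup G) (hSH : ∀ g : G, ∃ s ∈ S, ∃ h ∈ H, g = s * h) :
    Coinvariants.ker ρ = Coinvariants.ker (ρ.comp S.subtype) ⊔ Coinvariants.ker (ρ.comp H.subtype) := by
  refine le_antisymm (Submodule.span_le.2 ?_) (sup_le (ker_comp_subtype_le ρ S) (ker_comp_subtype_le ρ H))
  rintro _ ⟨⟨g, v⟩, rfl⟩
  obtain ⟨s, hs, h, hh, rfl⟩ := hSH g
  have hsplit : ρ (s * h) v - v = (ρ s (ρ h v) - ρ h v) + (ρ h v - v) := by rw [map_mul, Module.End.mul_apply]; abel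
  show ρ (s * h) v - v ∈ _
  rw [hsplit]
  exact Submodule.add_mem_sup (Coinvariants.sub_mem_ker (ρ := ρ.comp S.subtype) ⟨s, hs⟩ (ρ h v))
    (Coinvariants.sub_mem_ker (ρ := ρ.comp H.subtype) ⟨h, hh⟩ v)

end Stages

/-! ## §3 Quotients by an invariant submodule -/

section Quotient

variable {k G V : Type*} [CommRing k] [Group G] [AddCommGroup V] [Module k V] (ρ : Representation k G V)
  (W : Submodule k V) (hW : ∀ g, W ≤ W.comap (ρ g))

/-- `(ρ.quotient W) g [v] = [ρ g v]`. [folklore] -/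
theorem quotient_apply_mkQ (g : G) (v : V) : ρ.quotient W hW g (W.mkQ v) = W.mkQ (ρ g v) := rfl

/-- **THE IMAGE OF A TWISTED KERNEL IN A QUOTIENT**: `mkQ (ker (ρ.twist χ)) ≤ ker ((ρ.quotient W).twist χ)` (generator by generator). [folklore] -/
theorem map_mkQ_ker_twist_le (χ : G →* kˣ) :
    Submodule.map W.mkQ (Coinvariants.ker (ρ.twist χ)) ≤ Coinvariants.ker ((ρ.quotient W hW).twist χ) := by
  unfold Coinvariants.ker
  rw [Submodule.map_span, Submodule.span_le]
  rintro _ ⟨_, ⟨⟨g, v⟩, rfl⟩, rfl⟩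
  have key : W.mkQ (ρ.twist χ g v - v) = (ρ.quotient W hW).twist χ g (W.mkQ v) - W.mkQ v := by
    rw [map_sub, twist_apply, twist_apply, map_smul, quotient_apply_mkQ]
  rw [key]
  exact Coinvariants.sub_mem_ker g _

/-- **`ker = ⊤` DESCENDS WITH A COMPLEMENT**: if `W ⊔ ker (ρ.twist χ) = ⊤` then `ker ((ρ.quotient W).twist χ) = ⊤`. [folklore] -/
theorem ker_twist_quotient_eq_top_of_sup_eq_top (χ : G →* kˣ) (h : W ⊔ Coinvariants.ker (ρ.twist χ) = ⊤) :
    Coinvariants.ker ((ρ.quotient W hW).twist χ) = ⊤ := by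
  refine eq_top_iff.2 fun a _ => ?_
  obtain ⟨v, rfl⟩ := W.mkQ_surjective a
  have hv : v ∈ W ⊔ Coinvariants.ker (ρ.twist χ) := by rw [h]; exact Submodule.mem_top
  obtain ⟨w, hw, u, hu, rfl⟩ := Submodule.mem_sup.1 hv
  rw [map_add, Submodule.mkQ_apply, (Submodule.Quotient.mk_eq_zero W).2 hw, zero_add]
  exact map_mkQ_ker_twist_le ρ W hW χ ⟨u, hu, rfl⟩

variable [TopologicalSpace G] [IsTopologicalGroup G]

/-- **The quotient of a smooth representation is smooth** (the stabiliser of `[v]` contains that of `v`). [cite: BernsteinZelevinsky1976, §2.1] -/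
theorem isSmooth_quotient (hρ : ρ.IsSmooth) : (ρ.quotient W hW).IsSmooth := by
  intro a
  obtain ⟨v, rfl⟩ := W.mkQ_surjective a
  refine Subgroup.isOpen_mono ?_ (hρ v)
  intro g hg
  rw [mem_stabilizerSubgroup] at hg ⊢
  show W.mkQ (ρ g v) = W.mkQ v
  rw [hg]

/-- The twist of a representation with open stabilisers by a character with open kernel is smooth. [cite: BernsteinZelevinsky1976, §2.1] -/
theorem isSmooth_twist_of_isOpen_ker {σ : Representation k G V} (hσ : σ.IsSmooth) {χ : G →* kˣ} (hχ : IsOpen (χ.ker : Set G)) :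
    (σ.twist χ).IsSmooth :=
  hσ.twist hχ

end Quotient

/-! ## §4 Smooth characters of a limit of compact open subgroups: norm one, and additive duality along a root parametrisation -/

section Characters

variable {M : Type*} [Group M] [TopologicalSpace M] [IsTopologicalGroup M]

/-- A character with open kernel is locally constant. [folklore] -/
theorem isLocallyConstant_of_isOpen_ker (θ : M →* ℂˣ) (hθ : IsOpen (θ.ker : Set M)) : IsLocallyConstant θ := by
  refine (IsLocallyConstant.iff_exists_open θ).2 fun m => ⟨(fun y => m * y) '' (θ.ker : Set M), ?_, ⟨1, θ.ker.one_mem, mul_one m⟩, ?_⟩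
  · exact (Homeomorph.mulLeft m).isOpenMap _ hθ
  · rintro _ ⟨y, hy, rfl⟩
    rw [map_mul, (MonoidHom.mem_ker).1 hy, mul_one]

/-- **SMOOTH CHARACTERS OF A LIMIT OF COMPACT OPEN SUBGROUPS ARE UNITARY**: `‖θ(m)‖ = 1` (on a compact open subgroup `K ∋ m` the locally constant `θ` has finite
image, a finite subgroup of `ℂˣ`, so `θ(m)` has finite order). [cite: BernsteinZelevinsky1976, §1.1] -/
theorem norm_apply_eq_one_of_isOpen_ker (hM : IsLimitOfCompactOpen M) (θ : M →* ℂˣ) (hθ : IsOpen (θ.ker : Set M)) (m : M) : ‖((θ m : ℂˣ) : ℂ)‖ = 1 := by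
  obtain ⟨K, -, hKc, hmK⟩ := hM {m} isCompact_singleton
  have hm : m ∈ K := hmK (Set.mem_singleton m)
  haveI : CompactSpace ↥K := isCompact_iff_compactSpace.1 hKc
  -- the image of `K` is finite
  set θK : ↥K →* ℂˣ := θ.comp K.subtype with hθK
  have hlc : IsLocallyConstant θK := by
    refine (isLocallyConstant_of_isOpen_ker θ hθ).comp_continuous ?_
    exact continuous_subtype_val
  haveI hfin : Finite (Set.range θK) := (hlc.range_finite).to_subtype
  haveI : Finite θK.range := by
    have : (θK.range : Set ℂˣ) = Set.range θK := MonoidHom.coe_range θK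
    exact Set.finite_coe_iff.2 (this ▸ hlc.range_finite)
  -- so `θ m` has finite order
  have hmem : θK ⟨m, hm⟩ ∈ θK.range := ⟨⟨m, hm⟩, rfl⟩
  have hfo : IsOfFinOrder (⟨θK ⟨m, hm⟩, hmem⟩ : θK.range) := isOfFinOrder_of_finite _
  have hfo' : IsOfFinOrder (θ m) := by
    have := θK.range.subtype.isOfFinOrder hfo
    simpa [hθK] using this
  obtain ⟨n, hn, hpow⟩ := hfo'.exists_pow_eq_one
  have hpow' : (((θ m : ℂˣ) : ℂ)) ^ n = 1 := by rw [← Units.val_pow_eq_pow_val, hpow, Units.val_one]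
  exact Complex.norm_eq_one_of_pow_eq_one hpow' hn.ne'

variable {F : Type*} [Field F] [ValuativeRel F] [TopologicalSpace F] [IsNonarchimedeanLocalField F]

/-- **EVERY SMOOTH CHARACTER OF A ROOT GROUP IS `ψ(a·)`.**  Let `e : F → M` be a continuous additive parametrisation (`e(x+y) = e(x)e(y)`) into a group that is a
union of compact open subgroups, `θ : M →* ℂˣ` a character with open kernel, and `ψ` a non-trivial continuous additive character of `F`.  Then
`θ(e(x)) = ψ(a x)` for some `a ∈ F` (★ additive duality, after §4's unitarity turns `θ ∘ e` into a continuous `AddChar F Circle`).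
[cite: BushnellHenniart2006, §1.7 Proposition] [cite: BernsteinZelevinsky1976, §1.1] -/
theorem exists_eq_mulShift_comp_of_isOpen_ker {ψ : AddChar F Circle} (hψ : ψ.IsContinuousNontrivial) (hM : IsLimitOfCompactOpen M)
    (e : F → M) (he : Continuous e) (hadd : ∀ x y, e (x + y) = e x * e y) (θ : M →* ℂˣ) (hθ : IsOpen (θ.ker : Set M)) :
    ∃ a : F, ∀ x, ((θ (e x) : ℂˣ) : ℂ) = ψ (a * x) := by
  have h0 : e 0 = 1 := by
    have h := hadd 0 0
    rw [add_zero] at h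
    exact (mul_eq_left.1 h.symm)
  -- `θ ∘ e` as a continuous `AddChar F Circle`
  have hnorm : ∀ x, ‖((θ (e x) : ℂˣ) : ℂ)‖ = 1 := fun x => norm_apply_eq_one_of_isOpen_ker hM θ hθ (e x)
  let χ : AddChar F Circle :=
    { toFun := fun x => ⟨((θ (e x) : ℂˣ) : ℂ), mem_sphere_zero_iff_norm.2 (hnorm x)⟩
      map_zero_eq_one' := Circle.ext (by simp [h0])
      map_add_eq_mul' := fun x y => Circle.ext (by simp [hadd]) }
  have hχ : ∀ x, ((χ x : Circle) : ℂ) = ((θ (e x) : ℂˣ) : ℂ) := fun x => rfl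
  have hθc : Continuous fun m => ((θ m : ℂˣ) : ℂ) := Units.continuous_val.comp (isLocallyConstant_of_isOpen_ker θ hθ).continuous
  have hχc : Continuous χ := by
    refine Continuous.subtype_mk (hθc.comp he) _
  obtain ⟨a, ha⟩ := AddCharDuality.exists_eq_mulShift hψ hχc
  refine ⟨a, fun x => ?_⟩
  rw [← hχ, ha, AddChar.mulShift_apply]

/-- **TWO-PARAMETER VERSION** (for `U_Q ≅ F²`): with two continuous additive parametrisations `e₁, e₂ : F → M` such that every element of `M` is `e₁(x) e₂(y)`,
every character with open kernel is `θ(e₁ x · e₂ y) = ψ(a x + b y)`. [cite: BushnellHenniart2006, §1.7 Proposition] -/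
theorem exists_eq_addChar_of_isOpen_ker_two {ψ : AddChar F Circle} (hψ : ψ.IsContinuousNontrivial) (hM : IsLimitOfCompactOpen M)
    (e₁ e₂ : F → M) (he₁ : Continuous e₁) (he₂ : Continuous e₂) (hadd₁ : ∀ x y, e₁ (x + y) = e₁ x * e₁ y) (hadd₂ : ∀ x y, e₂ (x + y) = e₂ x * e₂ y)
    (θ : M →* ℂˣ) (hθ : IsOpen (θ.ker : Set M)) :
    ∃ a b : F, ∀ x y, ((θ (e₁ x * e₂ y) : ℂˣ) : ℂ) = ψ (a * x + b * y) := by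
  obtain ⟨a, ha⟩ := exists_eq_mulShift_comp_of_isOpen_ker hψ hM e₁ he₁ hadd₁ θ hθ
  obtain ⟨b, hb⟩ := exists_eq_mulShift_comp_of_isOpen_ker hψ hM e₂ he₂ hadd₂ θ hθ
  refine ⟨a, b, fun x y => ?_⟩
  rw [map_mul, Units.val_mul, ha, hb, AddChar.map_add_eq_mul, Circle.coe_mul]

end Characters

end Summit.HodgeConjecture.HodgeConjecture.Cruxes.H413.K2E3TwistedKernelTransport

end
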